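import Summits.BirchSwinnertonDyer.Rank1Residual.ManinAdditive.NegOneOptimalTwistRigidityProof
import HarnessLib

/-!
# THE SCALING ENGINE — FILE 6 (`TwistOrbitScalingEngine`, T-an-9 part 1/2): on a commuting twist orbit with
# lattice-optimal data the isomorphism's scaling is FORCED (`u.u·c = σ·c′`, `σρ = d`, `σ, ρ ∈ ℤ`), hence the DEGREE
# JUMP `deg′ ∈ {|d|·deg, deg/|d|}`; at `d = −1` (`2⁴ ∣ N`): `deg φ′ = deg φ` UNCONDITIONALLY on optimal `χ₋₄`-orbits
# (`negOne_optimal_modularDegree_eq`) and the unconditional package `negOne_optimal_orbit_sixteen` (§23, first half)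

PROVENANCE. Cell `bsd-f2-manin`, planner `bsd-f2-manin-an` g4: §23 `section ScalingEngine` of the kernel-checked
HOME/an/Sketch-an5v5.lean c12b594bf59501ac (= v4 + §23; 1752 lines; farm rc 0 · 0 err · 0 warn · 0 sorries; no new
imports; refuter-1 R-an-16 DONE 20:24Z), landed VERBATIM by the cell's typer in two files for the 400-line rule: this file =
the engine (`rat_den_eq_one_of_mul_ω₁_mem`, `optimal_commuting_scaling`, `optimal_commuting_degree`) and the `d = −1`
paragraph; `TwistOrbitScalingEngineJumps` = the `d = ±2` and odd `d = q*` paragraphs.  Theorems only, no `sorry`,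
no conjecture tags, no printed input.

MECHANISM (pure lattice algebra): two-sided twist steps `s·Λ(f′) ⊆ Λ(f)`, `s·Λ(f) ⊆ Λ(f′)` with `s² = d` (`s = g(χ)/2`
at `2` by HALF-TRANSLATE, files 1/4; `s = g(χ_q)` at odd `q` by Stevens (5.4)); lattice-optimality `Λ_W = cΛ(f)`,
`Λ_{W′} = c′Λ(f′)`; Pal's Lemma 3.1 `Λ_{W ⊗ d} = s⁻¹Λ_W`; and for an isomorphism `u : W ⊗ d ≅ W′`, `Λ_{W′} = (u.u)·Λ_{W ⊗ d}`.
Chasing `ω₁′` and `ω₁` once around gives `σ := u.u·c/c′ ∈ ℤ` and `ρ := d·c′/(u.u·c) ∈ ℤ` (a RATIONAL multiple of `ω₁`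
lies in the lattice only for an integer — Mathlib's `PeriodPair.mul_ω₁_add_mul_ω₂_mem_lattice`), with `σρ = d`.  Watkins'
identity with scaling (`deg′·c²·(u.u)² = |d|·deg·c′²`, tree) then reads `deg′·σ² = |d|·deg`, and `|σ| ∣ |d|` with `|d|`
equal to `1` or a prime gives the jump.  BC5 (data seat's TWISTCENSUS2, same-`N` rows `N ≤ 5·10⁵`): `d = −1`:
`Δ_deg = 0` on 296 234 / 296 234 (modular-symbol exact `deg′ = deg` 2 877 / 2 877); falsifiers 0 (HOME/MEMO-an.md §40e,
CANDIDATES row E-an-25).  Beyond print: YES (small, unconditional).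
References: [cite: Pal2012, Lemma 3.1] [cite: Watkins2002, §2.1 (p. 491)] [cite: Stevens1989, Lemma (5.4) p. 97]
[cite: SilvermanAEC2009, III.1 Table 3.1].
-/

noncomputable section

open scoped MatrixGroups ModularForm

open CongruenceSubgroup WeierstrassCurve
  Literature.NumberTheory.DiophantineGeometry
  Literature.NumberTheory.EllipticCurves
  Literature.NumberTheory.EllipticCurves.ModularForms

namespace Summit.BirchSwinnertonDyer.Rank1Residual.ManinAdditive

section ScalingEngine

/-! ## §23 THE SCALING ENGINE: on a commuting orbit with lattice-optimal data the isomorphism's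
## scaling is forced (`u.u · c = σ · c′`, `σ ∣ d`), hence the DEGREE JUMP `deg′ ∈ {|d|·deg, deg/|d|}`
## at every additive prime — `d = −1` (`2⁴ ∣ N`): `deg′ = deg` UNCONDITIONALLY; `d = ±2` (`2⁶ ∣ N`) without
## the `Δ′ = 64Δ` proviso of E-an-24; `d = q*` (`q` odd, `q² ∣ N`): `deg′ = q·deg ∨ q·deg′ = deg`, i.e.
## imc's FLIP is FORCED whenever `deg′ = deg` (E-imc-3b / 9b decided per orbit by the degree column).

Mechanism (pure lattice algebra, no print): two-sided twist steps `s·Λ(f′) ⊆ Λ(f)`, `s·Λ(f) ⊆ Λ(f′)` with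
`s² = d` (`s = g(χ)/2` at `2` by HALF-TRANSLATE §16/§21, `s = g(χ_q)` at odd `q` by Stevens (5.4));
lattice-optimality `Λ_W = cΛ(f)`, `Λ_{W′} = c′Λ(f′)`; Pal's Lemma 3.1 `Λ_{W ⊗ d} = s⁻¹Λ_W`; and for an
isomorphism `u : W ⊗ d ≅ W′`, `Λ_{W′} = (u.u)·Λ_{W ⊗ d}`.  Chasing `ω₁′` and `ω₁` once around gives
`σ := u.u·c/c′ ∈ ℤ` and `ρ := d·c′/(u.u·c) ∈ ℤ` (a RATIONAL multiple of `ω₁` lies in the lattice only for an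
integer — Mathlib's `PeriodPair.mul_ω₁_add_mul_ω₂_mem_lattice`), with `σρ = d`.  Watkins' identity with
scaling (`deg′·c²·(u.u)² = |d|·deg·c′²`, tree) then reads `deg′·σ² = |d|·deg`. -/

/-- A rational multiple of `ω₁` lies in the period lattice only if the multiplier is an integer. [Mathlib] -/
theorem rat_den_eq_one_of_mul_ω₁_mem (L : PeriodPair) {ρ : ℚ} (h : (ρ : ℂ) * L.ω₁ ∈ L.lattice) :
    ρ.den = 1 := by
  have h' : (ρ : ℂ) * L.ω₁ + ((0 : ℚ) : ℂ) * L.ω₂ ∈ L.lattice := by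
    rwa [Rat.cast_zero, zero_mul, add_zero]
  exact (PeriodPair.mul_ω₁_add_mul_ω₂_mem_lattice.mp h').1

/-- **THE SCALING ENGINE.** Two-sided twist steps with `s² = d`, lattice-optimal data `D`, `D′` (any levels)
and an isomorphism `u • (W ⊗ d) = W′` force `u.u · c = σ · c′` with `σ, ρ ∈ ℤ`, `σρ = d`.
[cite: Pal2012, Lemma 3.1] [cite: SilvermanAEC2009, III.1 Table 3.1] -/
theorem optimal_commuting_scaling {W W' : WeierstrassCurve ℚ} [W.IsElliptic] [W'.IsElliptic]
    {N N' : ℕ} [NeZero N] [NeZero N'] (D : ModularParametrizationData W N)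
    (D' : ModularParametrizationData W' N') (hD : IsLatticeOptimal D) (hD' : IsLatticeOptimal D')
    {d : ℚ} (hd : d ≠ 0) {s : ℂ} (hs0 : s ≠ 0) (hs : s ^ 2 = (d : ℂ))
    (h1 : ∀ w ∈ periodLattice D'.f, s * w ∈ periodLattice D.f)
    (h2 : ∀ w ∈ periodLattice D.f, s * w ∈ periodLattice D'.f)
    (u : VariableChange ℚ) (hu : u • W.quadraticTwist d = W') :
    ∃ σ ρ : ℤ, (σ : ℚ) * ρ = d ∧ ((u.u : ℚ)) * D.c = σ * D'.c := by
  haveI := W.isElliptic_quadraticTwist hd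
  have hc0 : (D.c : ℂ) ≠ 0 := D.cast_c_ne_zero
  have hc0' : (D'.c : ℂ) ≠ 0 := D'.cast_c_ne_zero
  have hcq : (D.c : ℚ) ≠ 0 := by exact_mod_cast (Int.cast_ne_zero.mp hc0)
  have hcq' : (D'.c : ℚ) ≠ 0 := by exact_mod_cast (Int.cast_ne_zero.mp hc0')
  have hυ0 : ((u.u : ℚ)) ≠ 0 := u.u.ne_zero
  have hυ0' : (((u.u : ℚ)) : ℂ) ≠ 0 := by exact_mod_cast hυ0
  -- the Néron-type pair `s⁻¹ Λ_W` of the twisted model, and `Λ_{W′} = u.u · s⁻¹ Λ_W`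
  have hLT := WeierstrassCurve.isNeronLatticeOf_quadraticTwist_of_sq_eq d D.isNeronLattice hs0 hs
  have hLW' : IsNeronLatticeOf ((u • W.quadraticTwist d).baseChange ℂ) D'.L := by
    rw [hu]; exact D'.isNeronLattice
  have hlat := IsNeronLatticeOf.lattice_eq_mulLeft_of_smul u hLT hLW'
  have hmem : ∀ z : ℂ, z ∈ D'.L.lattice ↔ s * (((((u.u : ℚ)) : ℂ))⁻¹ * z) ∈ D.L.lattice := fun z ↦ by
    rw [hlat, PeriodPair.mem_mulLeft_lattice, PeriodPair.mem_mulLeft_lattice, inv_inv]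
  -- `σ := u.u · c / c′` maps `ω₁′` into `Λ_{W′}`
  obtain ⟨w', hw', he'⟩ := hD' _ D'.L.ω₁_mem_lattice
  have hσmem : ((((u.u : ℚ)) * D.c / D'.c : ℚ) : ℂ) * D'.L.ω₁ ∈ D'.L.lattice := by
    have h3 : (D.c : ℂ) * (s * w') ∈ D.L.lattice := D.smul_periodLattice_le _ (h1 w' hw')
    have h4 : (((u.u : ℚ)) : ℂ) * ((D.c : ℂ) * w') ∈ D'.L.lattice := by
      rw [hmem, show s * (((((u.u : ℚ)) : ℂ))⁻¹ * ((((u.u : ℚ)) : ℂ) * ((D.c : ℂ) * w'))) =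
        ((((u.u : ℚ)) : ℂ))⁻¹ * (((u.u : ℚ)) : ℂ) * ((D.c : ℂ) * (s * w')) by ring,
        inv_mul_cancel₀ hυ0', one_mul]
      exact h3
    rw [he']
    convert h4 using 1
    push_cast
    field_simp
  -- `ρ := d · c′ / (u.u · c)` maps `ω₁` into `Λ_W`
  obtain ⟨w, hw, he⟩ := hD _ D.L.ω₁_mem_lattice
  have hρmem : (((d * D'.c / (((u.u : ℚ)) * D.c) : ℚ)) : ℂ) * D.L.ω₁ ∈ D.L.lattice := by
    have h3 : (D'.c : ℂ) * (s * w) ∈ D'.L.lattice := D'.smul_periodLattice_le _ (h2 w hw)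
    have h4 := (hmem _).mp h3
    rw [show s * (((((u.u : ℚ)) : ℂ))⁻¹ * ((D'.c : ℂ) * (s * w))) =
      s ^ 2 * ((((((u.u : ℚ)) : ℂ))⁻¹ * ((D'.c : ℂ) * w))) by ring, hs] at h4
    rw [he]
    convert h4 using 1
    push_cast
    field_simp
  have hσden := rat_den_eq_one_of_mul_ω₁_mem D'.L hσmem
  have hρden := rat_den_eq_one_of_mul_ω₁_mem D.L hρmem
  have hσ := (Rat.den_eq_one_iff _).mp hσden
  have hρ := (Rat.den_eq_one_iff _).mp hρden
  refine ⟨(((u.u : ℚ)) * D.c / D'.c : ℚ).num, (d * D'.c / (((u.u : ℚ)) * D.c) : ℚ).num, ?_, ?_⟩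
  · rw [hσ, hρ]
    field_simp
  · rw [hσ]
    field_simp

/-- **THE DEGREE JUMP.** Under the engine's hypotheses at a common level, with `|aₙ(W′)| = |aₙ(W)|` and
`|d| = a` having no divisors other than `1` and `a` (`a = 1` or `a` prime): `deg′ = a·deg ∨ a·deg′ = deg`.
[cite: Watkins2002, §2.1 (p. 491)] [cite: Pal2012, Lemma 3.1] -/
theorem optimal_commuting_degree {W W' : WeierstrassCurve ℚ} [W.IsElliptic] [W'.IsElliptic]
    {N N' : ℕ} [NeZero N] [NeZero N'] (hNN : N' = N) (D : ModularParametrizationData W N)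
    (D' : ModularParametrizationData W' N') (hD : IsLatticeOptimal D) (hD' : IsLatticeOptimal D')
    {d : ℚ} (hd : d ≠ 0) {s : ℂ} (hs0 : s ≠ 0) (hs : s ^ 2 = (d : ℂ))
    (h1 : ∀ w ∈ periodLattice D'.f, s * w ∈ periodLattice D.f)
    (h2 : ∀ w ∈ periodLattice D.f, s * w ∈ periodLattice D'.f)
    (u : VariableChange ℚ) (hu : u • W.quadraticTwist d = W')
    (habs : ∀ n : ℕ, (W'.LFunction n).natAbs = (W.LFunction n).natAbs)
    {a : ℕ} (ha : |(d : ℝ)| = a) (hpr : ∀ m : ℕ, m ∣ a → m = 1 ∨ m = a) :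
    D'.modularDegree = a * D.modularDegree ∨ a * D'.modularDegree = D.modularDegree := by
  subst hNN
  obtain ⟨σ, ρ, hσρ, hσc⟩ := optimal_commuting_scaling D D' hD hD' hd hs0 hs h1 h2 u hu
  have key := ModularParametrizationData.deg_mul_sq_mul_sq_eq_of_quadraticTwist_of_natAbs_eq d hd u hu
    habs D D'
  have hc' : (D'.c : ℝ) ≠ 0 := by exact_mod_cast D'.maninConstant_ne_zero_holds
  have ha0 : a ≠ 0 := by
    rintro rfl
    rw [Nat.cast_zero, abs_eq_zero] at ha
    exact hd (by exact_mod_cast ha)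
  have hσcR : (((u.u : ℚ)) : ℝ) * (D.c : ℝ) = (σ : ℝ) * (D'.c : ℝ) := by
    have h := congrArg (fun x : ℚ ↦ (x : ℝ)) hσc
    push_cast at h
    exact h
  have hσρR : (σ : ℝ) * (ρ : ℝ) = ((d : ℚ) : ℝ) := by
    have h := congrArg (fun x : ℚ ↦ (x : ℝ)) hσρ
    push_cast at h
    exact h
  -- `deg′ σ² = a deg`
  have e1 : (D'.deg : ℝ) * (σ : ℝ) ^ 2 * (D'.c : ℝ) ^ 2 = (a : ℝ) * D.deg * (D'.c : ℝ) ^ 2 := by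
    rw [← ha, ← key, show (D'.deg : ℝ) * (σ : ℝ) ^ 2 * (D'.c : ℝ) ^ 2 =
      (D'.deg : ℝ) * ((σ : ℝ) * (D'.c : ℝ)) ^ 2 by ring, ← hσcR]
    ring
  have e2 : (D'.deg : ℝ) * (σ : ℝ) ^ 2 = (a : ℝ) * D.deg := mul_right_cancel₀ (pow_ne_zero 2 hc') e1
  have e3 : D'.deg * σ.natAbs ^ 2 = a * D.deg := by
    have h : ((D'.deg * σ.natAbs ^ 2 : ℕ) : ℝ) = ((a * D.deg : ℕ) : ℝ) := by
      push_cast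
      rw [Nat.cast_natAbs, Int.cast_abs, sq_abs]
      exact e2
    exact_mod_cast h
  -- `|σ| · |ρ| = a`, so `|σ| ∈ {1, a}`
  have hprod : σ.natAbs * ρ.natAbs = a := by
    have h : (((σ * ρ).natAbs : ℕ) : ℝ) = a := by
      rw [Nat.cast_natAbs, Int.cast_abs, Int.cast_mul, hσρR, ha]
    rw [← Int.natAbs_mul]
    exact_mod_cast h
  rcases hpr σ.natAbs (Dvd.intro _ hprod) with h1 | h1
  · left
    rw [h1, one_pow, mul_one] at e3
    exact e3
  · right
    rw [h1] at e3
    have h : a * (a * D'.deg) = a * D.deg := by rw [← e3]; ring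
    exact Nat.eq_of_mul_eq_mul_left (Nat.pos_of_ne_zero ha0) h

/-! ### `d = −1`: the modular degree is CONSTANT on optimal `χ₋₄`-orbits (`2⁴ ∣ N`), unconditionally -/

/-- **THM I, degree clause, UNCONDITIONAL (commuting form; `16 ∣ M`):** on a same-level `χ₋₄`-orbit with
`u • (W ⊗ χ₋₄) = W′` and both data lattice-optimal, `deg φ′ = deg φ` — no `Δ′ = Δ` hypothesis (E-an-23 had
one). [cite: Stevens1989, Lemma (5.4)] [cite: Pal2012, Lemma 3.1] [cite: Watkins2002, §2.1] -/
theorem negOne_optimal_commuting_modularDegree_eq {M : ℕ} (hM : 16 ∣ M) :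
    ∀ (W W' : WeierstrassCurve ℚ) [W.IsElliptic] [W.IsGloballyMinimal] [W'.IsElliptic]
      [W'.IsGloballyMinimal] [NeZero (W.conductorNorm ℤ)] [NeZero (W'.conductorNorm ℤ)]
      (u : VariableChange ℚ) (D : ModularParametrizationData W (W.conductorNorm ℤ))
      (D' : ModularParametrizationData W' (W'.conductorNorm ℤ)),
      M ∣ W.conductorNorm ℤ → W'.conductorNorm ℤ = W.conductorNorm ℤ →
      u • W.quadraticTwist ((-1 : ℤ) : ℚ) = W' → IsLatticeOptimal D → IsLatticeOptimal D' →
      D'.modularDegree = D.modularDegree := by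
  intro W W' _ _ _ _ _ _ u D D' hMN hN hu hD hD'
  haveI : Fact (Nat.Prime 2) := ⟨Nat.prime_two⟩
  have hd0 : ((-1 : ℤ) : ℚ) ≠ 0 := by norm_num
  have h16 : 4 ^ 2 ∣ W.conductorNorm ℤ := dvd_trans (by norm_num) (hM.trans hMN)
  have h4 : 2 ^ 2 ∣ W.conductorNorm ℤ := dvd_trans (by norm_num) h16
  have h4' : 2 ^ 2 ∣ W'.conductorNorm ℤ := by rw [hN]; exact h4
  obtain ⟨hngW, hnmW⟩ := not_good_and_not_mult_of_sq_dvd_conductorNorm W h4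
  obtain ⟨hngW', hnmW'⟩ := not_good_and_not_mult_of_sq_dvd_conductorNorm W' h4'
  have hW0 : ∀ n : ℕ, 2 ∣ n → W.LFunction n = 0 := fun n hn ↦
    W.LFunction_apply_eq_zero_of_not_good_of_not_mult 2 hngW hnmW hn
  have hW'0 : ∀ n : ℕ, 2 ∣ n → W'.LFunction n = 0 := fun n hn ↦
    W'.LFunction_apply_eq_zero_of_not_good_of_not_mult 2 hngW' hnmW' hn
  have habs := natAbs_LFunction_eq_of_twist_even hd0 u hu (fun n ↦ ZMod.χ₄ n) natAbs_χ₄_of_odd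
    (LFunction_quadraticTwist_negOne_intCast_of_odd W) hW0 hW'0
  have hiso : IsIsogenous (W.quadraticTwist ((-1 : ℤ) : ℚ)) W' :=
    WeierstrassCurve.isIsogenous_of_smul_eq hu
  obtain ⟨h1, h2⟩ := half_gaussSum_χ₄_mul_mem_periodLattice_twoSided D D' h16 hN hiso
  have hs : (gaussSum (ZMod.χ₄.ringHomComp (Int.castRingHom ℂ)) (ZMod.stdAddChar (N := 4)) / 2) ^ 2 =
      ((((-1 : ℤ) : ℚ)) : ℂ) := by
    rw [div_pow, gaussSum_χ₄_ringHomComp_sq]; push_cast; ring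
  have hs0 : gaussSum (ZMod.χ₄.ringHomComp (Int.castRingHom ℂ)) (ZMod.stdAddChar (N := 4)) / 2 ≠ 0 := by
    intro h0
    rw [h0] at hs
    norm_num at hs
  have ha : |((((-1 : ℤ) : ℚ)) : ℝ)| = (1 : ℕ) := by norm_num
  rcases optimal_commuting_degree hN D D' hD hD' hd0 hs0 hs h1 h2 u hu habs ha
      (fun m hm ↦ Or.inl (Nat.dvd_one.mp hm)) with h | h
  · rw [h, one_mul]
  · rw [← h, one_mul]

/-- **THM I, degree clause, UNCONDITIONAL (orbit form, `2⁴ ∣ N`):** on a same-level `χ₋₄`-orbit with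
`W ⊗ χ₋₄ ~ W′` and both data lattice-optimal, `deg φ′ = deg φ` (rigidity §22 supplies the isomorphism).
Print (Pal 2.4 / Connell 5.7.3) is now needed ONLY for the sign-free Manin clause `c′ = ±c ⟺ Δ′ = Δ`. -/
theorem negOne_optimal_modularDegree_eq : ∀ (W W' : WeierstrassCurve ℚ) [W.IsElliptic]
    [W.IsGloballyMinimal] [W'.IsElliptic] [W'.IsGloballyMinimal] [NeZero (W.conductorNorm ℤ)]
    [NeZero (W'.conductorNorm ℤ)] (D : ModularParametrizationData W (W.conductorNorm ℤ))
    (D' : ModularParametrizationData W' (W'.conductorNorm ℤ)),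
    IsLatticeOptimal D → IsLatticeOptimal D' →
    16 ∣ W.conductorNorm ℤ → W'.conductorNorm ℤ = W.conductorNorm ℤ →
    IsIsogenous (W.quadraticTwist ((-1 : ℤ) : ℚ)) W' →
    D'.modularDegree = D.modularDegree := by
  intro W W' _ _ _ _ _ _ D D' hD hD' h16 hN hiso
  obtain ⟨u, hu⟩ := negOneOptimalTwistRigidity_sixteen W W' D D' hD hD' h16 hN hiso
  exact negOne_optimal_commuting_modularDegree_eq (dvd_refl 16) W W' u D D' h16 hN hu hD hD'

/-- **The unconditional `χ₋₄`-orbit package at `2⁴ ∣ N`:** rigidity `W ⊗ χ₋₄ ≅ W′`, `deg φ′ = deg φ`, and the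
Manin–discriminant identity `c′¹²·Δ′ = c¹²·Δ` — all three sorry-free, no printed input. -/
theorem negOne_optimal_orbit_sixteen : ∀ (W W' : WeierstrassCurve ℚ) [W.IsElliptic]
    [W.IsGloballyMinimal] [W'.IsElliptic] [W'.IsGloballyMinimal] [NeZero (W.conductorNorm ℤ)]
    [NeZero (W'.conductorNorm ℤ)] (D : ModularParametrizationData W (W.conductorNorm ℤ))
    (D' : ModularParametrizationData W' (W'.conductorNorm ℤ)),
    IsLatticeOptimal D → IsLatticeOptimal D' →
    16 ∣ W.conductorNorm ℤ → W'.conductorNorm ℤ = W.conductorNorm ℤ →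
    IsIsogenous (W.quadraticTwist ((-1 : ℤ) : ℚ)) W' →
    (∃ u : VariableChange ℚ, u • W.quadraticTwist ((-1 : ℤ) : ℚ) = W') ∧
      D'.modularDegree = D.modularDegree ∧ (D'.c : ℚ) ^ 12 * W'.Δ = (D.c : ℚ) ^ 12 * W.Δ := by
  intro W W' _ _ _ _ _ _ D D' hD hD' h16 hN hiso
  exact ⟨negOneOptimalTwistRigidity_sixteen W W' D D' hD hD' h16 hN hiso,
    negOne_optimal_modularDegree_eq W W' D D' hD hD' h16 hN hiso,
    negOne_optimal_c_pow_twelve_mul_Δ_eq W W' D D' hD hD' h16 hN hiso⟩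

end ScalingEngine

end Summit.BirchSwinnertonDyer.Rank1Residual.ManinAdditive
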